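import Literature.NumberTheory.NumberFields.CyclotomicFieldsSevenNineClassNumber
import Literature.NumberTheory.NumberFields.CyclotomicFieldsEightSixteenClassNumber
import Literature.NumberTheory.NumberFields.CyclotomicFieldFourClassNumber
import Literature.NumberTheory.NumberFields.CyclotomicFieldTwelveClassNumber
import Literature.NumberTheory.NumberFields.CyclotomicFieldFifteenClassNumber
import Literature.NumberTheory.NumberFields.CyclotomicFieldTwentyClassNumber
import Literature.NumberTheory.NumberFields.CyclotomicFieldTwentyFourClassNumber
import Literature.NumberTheory.Automorphic.Arthur2013.Leaves.TorusCyclotomic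
import Mathlib.NumberTheory.NumberField.Cyclotomic.PID
import HarnessLib

/-!
# `h(ℚ(ζ_d)) = 1` for every cyclotomic field of degree `φ(d) ≤ 8`

Layer `Literature/NumberTheory/NumberFields`, namespace `Literature.NumberTheory.NumberFields`; lane `lit-hodgefound` (Track 2
foundations library), prover seat `lit-hodgefound-p10`, generation 33, row «A2-26(hd)» (self-proposed 2026-08-28).  Theorems only;
no `def`, no instance, no named fact (net Literature debt 0).

The first sixteen cases `d > 2`, `φ(d) ≤ 8` — `d ∈ {3, 4, 5, 6, 7, 8, 9, 10, 12, 14, 15, 16, 18, 20, 24, 30}` (§1, elementary: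
`p ∣ d ⟹ p − 1 ∣ φ(d)`-type bounds give `d ∣ 5040 = 2⁴·3²·5·7`, then inspection of the `60` divisors) — of the
Masley–Montgomery theorem («`h(ℚ(ζ_d)) = 1` iff `φ(d) ≤ 20` or `d ∈ {35, 45, 84}`», `d ≢ 2 (mod 4)`), assembled from Mathlib
(`three_pid`, `five_pid`), the tree's `ℚ(ζ₄)`, `ℚ(ζ₇)`, `ℚ(ζ₉)`, `ℚ(ζ₈)`, `ℚ(ζ₁₆)` files and this generation's `ℚ(ζ₁₂)`,
`ℚ(ζ₁₅)`, `ℚ(ζ₂₀)`, `ℚ(ζ₂₄)` files, with `ℚ(ζ_{2m}) = ℚ(ζ_m)` for odd `m` (the tree's `isCyclotomicExtension_of_two_mul_of_odd`)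
for `d = 6, 10, 14, 18, 30`.  These are exactly the cyclotomic fields by whose CM types the complex tori of dimension `≤ 4` with
an endomorphism of cyclotomic characteristic polynomial are uniformised (`Literature/Geometry/Kaehler/ComplexTorusCyclotomic…`):
«isomorphic ⟺ isogenous» for all of them rests on this file's statement.

* §1 `dvd_of_totient_le_eight` (`0 < d`, `φ(d) ≤ 8 ⟹ d ∣ 5040`), **`eq_of_two_lt_of_totient_le_eight`** (the sixteen values).
* §2 **`classNumber_eq_one_of_isCyclotomicExtension_of_totient_le_eight`**,
  `isPrincipalIdealRing_ringOfIntegers_of_isCyclotomicExtension_of_totient_le_eight`,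
  `classNumber_cyclotomicField_of_totient_le_eight`.

## References

* [Washington1997] L. C. Washington, *Introduction to Cyclotomic Fields*, 2nd ed., Springer GTM 83 (1997), Ch. 2
  (`ℚ(ζ_{2m}) = ℚ(ζ_m)`), Thm. 11.1 (Masley–Montgomery) and the tables of §11.
* [Marcus1977] D. A. Marcus, *Number Fields*, Springer (1977), Ch. 5 (Minkowski-bound class-number computations).
-/

noncomputable section

open scoped NumberField
open NumberField

namespace Literature.NumberTheory.NumberFields

open Literature.NumberTheory.Automorphic.Arthur2013.Leaves.TECR.TorusDict (isCyclotomicExtension_of_two_mul_of_odd)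

/-! ### §1 `φ(d) ≤ 8`, `d > 2 ⟺ d ∈ {3, 4, 5, 6, 7, 8, 9, 10, 12, 14, 15, 16, 18, 20, 24, 30}` -/

/-- **`φ(d) ≤ 8 ⟹ d ∣ 5040 = 2⁴·3²·5·7`** (`d > 0`): a prime `p ∣ d` has `p − 1 = φ(p) ∣ φ(d)`, so `p ≤ 9`; `p^k ∣ d` gives
`φ(p^k) = p^{k−1}(p − 1) ≤ 8`, so `k ≤ 4, 2, 1, 1` for `p = 2, 3, 5, 7`. [cite: Washington1997, Ch. 2] [folklore] -/
theorem dvd_of_totient_le_eight {d : ℕ} (hd : 0 < d) (h : Nat.totient d ≤ 8) : d ∣ 5040 := by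
  have hd0 : d ≠ 0 := hd.ne'
  have hφ0 : 0 < Nat.totient d := Nat.totient_pos.2 hd
  rw [← Nat.factorization_le_iff_dvd hd0 (by norm_num), Finsupp.le_def]
  intro p
  by_cases hp : p.Prime
  swap
  · rw [Nat.factorization_eq_zero_of_not_prime d hp]; exact Nat.zero_le _
  set k := d.factorization p with hk
  rcases Nat.eq_zero_or_pos k with hk0 | hkpos
  · rw [hk0]; exact Nat.zero_le _
  have hpk : p ^ k ∣ d := Nat.ordProj_dvd d p
  have hφdvd : p ^ (k - 1) * (p - 1) ∣ Nat.totient d := by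
    rw [← Nat.totient_prime_pow hp hkpos]; exact Nat.totient_dvd_of_dvd hpk
  have hφle : p ^ (k - 1) * (p - 1) ≤ 8 := (Nat.le_of_dvd hφ0 hφdvd).trans h
  have hp1 : p - 1 ≤ 8 := le_trans (Nat.le_mul_of_pos_left _ (pow_pos hp.pos _)) hφle
  have hpowle : p ^ (k - 1) ≤ 8 := le_trans (Nat.le_mul_of_pos_right _ (by have := hp.two_le; omega)) hφle
  rw [← hp.pow_dvd_iff_le_factorization (by norm_num)]
  have h2 := hp.two_le
  have hp9 : p ≤ 9 := by omega
  interval_cases p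
  · -- p = 2 : k ≤ 4
    have hk4 : k ≤ 4 := by
      by_contra hc
      have h16 : 2 ^ 4 ≤ 2 ^ (k - 1) := Nat.pow_le_pow_right (by norm_num) (by omega)
      omega
    exact (pow_dvd_pow 2 hk4).trans (by norm_num)
  · -- p = 3 : k ≤ 2
    have hk2 : k ≤ 2 := by
      by_contra hc
      have h9 : 3 ^ 2 ≤ 3 ^ (k - 1) := Nat.pow_le_pow_right (by norm_num) (by omega)
      omega
    exact (pow_dvd_pow 3 hk2).trans (by norm_num)
  · exact absurd hp (by norm_num)
  · -- p = 5 : k = 1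
    have hk1 : k ≤ 1 := by
      by_contra hc
      have h5 : 5 ^ 1 ≤ 5 ^ (k - 1) := Nat.pow_le_pow_right (by norm_num) (by omega)
      omega
    exact (pow_dvd_pow 5 hk1).trans (by norm_num)
  · exact absurd hp (by norm_num)
  · -- p = 7 : k = 1
    have hk1 : k ≤ 1 := by
      by_contra hc
      have h7 : 7 ^ 1 ≤ 7 ^ (k - 1) := Nat.pow_le_pow_right (by norm_num) (by omega)
      omega
    exact (pow_dvd_pow 7 hk1).trans (by norm_num)
  · exact absurd hp (by norm_num)
  · exact absurd hp (by norm_num)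

set_option maxRecDepth 20000 in
/-- **`d > 2`, `φ(d) ≤ 8 ⟹ d ∈ {3, 4, 5, 6, 7, 8, 9, 10, 12, 14, 15, 16, 18, 20, 24, 30}`** (inspection of the divisors of `5040`).
[cite: Washington1997, Ch. 2] [folklore] -/
theorem eq_of_two_lt_of_totient_le_eight {d : ℕ} (hd : 2 < d) (h : Nat.totient d ≤ 8) :
    d = 3 ∨ d = 4 ∨ d = 5 ∨ d = 6 ∨ d = 7 ∨ d = 8 ∨ d = 9 ∨ d = 10 ∨ d = 12 ∨ d = 14 ∨ d = 15 ∨ d = 16 ∨ d = 18 ∨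
      d = 20 ∨ d = 24 ∨ d = 30 := by
  have hmem : d ∈ Nat.divisors 5040 := Nat.mem_divisors.2 ⟨dvd_of_totient_le_eight (by omega) h, by norm_num⟩
  have key : ∀ x ∈ Nat.divisors 5040, 2 < x → Nat.totient x ≤ 8 →
      x = 3 ∨ x = 4 ∨ x = 5 ∨ x = 6 ∨ x = 7 ∨ x = 8 ∨ x = 9 ∨ x = 10 ∨ x = 12 ∨ x = 14 ∨ x = 15 ∨ x = 16 ∨ x = 18 ∨
        x = 20 ∨ x = 24 ∨ x = 30 := by
    decide +kernel
  exact key d hmem hd h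

/-! ### §2 `h(ℚ(ζ_d)) = 1` for `φ(d) ≤ 8` -/

/-- **`h(ℚ(ζ_d)) = 1` FOR EVERY CYCLOTOMIC FIELD OF DEGREE `φ(d) ≤ 8`** (`d > 2`; the sixteen fields `ℚ(ζ₃) = ℚ(ζ₆)`, `ℚ(i)`,
`ℚ(ζ₅) = ℚ(ζ₁₀)`, `ℚ(ζ₇) = ℚ(ζ₁₄)`, `ℚ(ζ₈)`, `ℚ(ζ₉) = ℚ(ζ₁₈)`, `ℚ(ζ₁₂)`, `ℚ(ζ₁₅) = ℚ(ζ₃₀)`, `ℚ(ζ₁₆)`, `ℚ(ζ₂₀)`, `ℚ(ζ₂₄)`) — the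
first cases of the Masley–Montgomery theorem. [cite: Washington1997, Thm. 11.1] [cite: Marcus1977, Ch. 5] -/
theorem classNumber_eq_one_of_isCyclotomicExtension_of_totient_le_eight {d : ℕ} (K : Type) [Field K] [NumberField K]
    (hK : IsCyclotomicExtension {d} ℚ K) (hd : 2 < d) (h8 : Nat.totient d ≤ 8) : classNumber K = 1 := by
  rcases eq_of_two_lt_of_totient_le_eight hd h8 with
    rfl | rfl | rfl | rfl | rfl | rfl | rfl | rfl | rfl | rfl | rfl | rfl | rfl | rfl | rfl | rfl
  · exact (classNumber_eq_one_iff (K := K)).2 (IsCyclotomicExtension.Rat.three_pid K)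
  · exact (classNumber_eq_one_iff (K := K)).2 (isPrincipalIdealRing_ringOfIntegers_of_isCyclotomicExtension_four K)
  · exact (classNumber_eq_one_iff (K := K)).2 (IsCyclotomicExtension.Rat.five_pid K)
  · haveI : IsCyclotomicExtension {2 * 3} ℚ K := hK
    haveI := isCyclotomicExtension_of_two_mul_of_odd (K := K) (m := 3) (by decide)
    exact (classNumber_eq_one_iff (K := K)).2 (IsCyclotomicExtension.Rat.three_pid K)
  · exact classNumber_eq_one_of_isCyclotomicExtension_seven K hK
  · exact classNumber_eq_one_of_isCyclotomicExtension_eight K hK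
  · exact classNumber_eq_one_of_isCyclotomicExtension_nine K hK
  · haveI : IsCyclotomicExtension {2 * 5} ℚ K := hK
    haveI := isCyclotomicExtension_of_two_mul_of_odd (K := K) (m := 5) (by decide)
    exact (classNumber_eq_one_iff (K := K)).2 (IsCyclotomicExtension.Rat.five_pid K)
  · exact classNumber_eq_one_of_isCyclotomicExtension_twelve K hK
  · haveI : IsCyclotomicExtension {2 * 7} ℚ K := hK
    exact classNumber_eq_one_of_isCyclotomicExtension_seven K
      (isCyclotomicExtension_of_two_mul_of_odd (K := K) (m := 7) (by decide))
  · exact classNumber_eq_one_of_isCyclotomicExtension_fifteen K hK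
  · exact classNumber_eq_one_of_isCyclotomicExtension_sixteen K hK
  · haveI : IsCyclotomicExtension {2 * 9} ℚ K := hK
    exact classNumber_eq_one_of_isCyclotomicExtension_nine K
      (isCyclotomicExtension_of_two_mul_of_odd (K := K) (m := 9) (by decide))
  · exact classNumber_eq_one_of_isCyclotomicExtension_twenty K hK
  · exact classNumber_eq_one_of_isCyclotomicExtension_twentyFour K hK
  · haveI : IsCyclotomicExtension {2 * 15} ℚ K := hK
    exact classNumber_eq_one_of_isCyclotomicExtension_fifteen K
      (isCyclotomicExtension_of_two_mul_of_odd (K := K) (m := 15) (by decide))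

/-- **`𝓞_K` is a principal ideal domain for every cyclotomic field `K` of degree `≤ 8`.** [cite: Washington1997, Thm. 11.1] -/
theorem isPrincipalIdealRing_ringOfIntegers_of_isCyclotomicExtension_of_totient_le_eight {d : ℕ} (K : Type) [Field K]
    [NumberField K] (hK : IsCyclotomicExtension {d} ℚ K) (hd : 2 < d) (h8 : Nat.totient d ≤ 8) :
    IsPrincipalIdealRing (𝓞 K) :=
  (classNumber_eq_one_iff (K := K)).1 (classNumber_eq_one_of_isCyclotomicExtension_of_totient_le_eight K hK hd h8)

/-- **`h(ℚ(ζ_d)) = 1` for Mathlib's `CyclotomicField d ℚ`, `d > 2`, `φ(d) ≤ 8`.** [cite: Washington1997, Thm. 11.1] -/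
theorem classNumber_cyclotomicField_of_totient_le_eight {d : ℕ} (hd : 2 < d) (h8 : Nat.totient d ≤ 8) :
    classNumber (CyclotomicField d ℚ) = 1 :=
  haveI : NeZero d := ⟨by omega⟩
  classNumber_eq_one_of_isCyclotomicExtension_of_totient_le_eight (CyclotomicField d ℚ)
    (CyclotomicField.isCyclotomicExtension d ℚ) hd h8

end Literature.NumberTheory.NumberFields

end
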